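import Summits.QuantumFields.BalabanUV.T4Continuum.Support.NE9CubeCurrencyBudget

/-!
# NE9LinSizeCurrencyBudget — N2-ter: the N2-bis budget RE-RUN on the d-currency lip side (E2′ ∕ E5″ of `NE9LinSizePinned`):
kernel-exact comparison «cube-count currency vs Bałaban's linear size» for the Lipschitz-scale binder of row NE9's END faces
(cell `pub-balaban`, node U3 ∕ spine estimate NE9, rung (B)+1 on a FIXED finite T⁴; NE9 formalisation crew, unit
`b2b-balaban-t4-ne9-formalise-leaf-01` gen 2, census item «N2-ter §A», companion of N2-bis `NE9CubeCurrencyBudget` (gen 1) and of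
the N2 census `NE9FadingArithmetic` ∕ `NE9FadingCensus.md` (leaf-10))

HONEST FRAMING (T4-DAG PAGE 1).  Rung (B)+1 on a fixed finite torus; NOT infinite volume, NOT the mass gap, NOT Clay.  NE9 is
NOT PRINTED and NOT proved; this module is OUR OWN bookkeeping (pure real arithmetic), asserts nothing about Bałaban's objects,
re-wires no END face and introduces no `def`.  HONEST DEPENDENCY: continuum YM on T⁴ ⇐ BetaPertH ∧ nine spine estimates (0/9
proved); BetaPertH ⇐ (D1) ∧ (D4) ∧ CAP+tail; G-an2-4 gates asym, D1 and NE2/3/4.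

WHAT IS RECORDED.  The census finding F-ne9leaf01-1 (journal l.6309; kernel necessary conditions = N2-bis) observed that the
torus END faces E2 `T4HistoryLipschitzLinearSize.torus_ne9_and_fadingMemory_of_linSizeDecay` ∕ E5
`NE9PrintedMajorantDecay.torus_ne9_and_fadingMemory_of_printedDecay` discharge the pinned coefficient sums (TYPE [II] (1.26) p. 8)
in CUBE-COUNT currency, through the two scalars
* `hθ₁    : exp (-(a / 2 ^ ν)) * exp (D * θ₁) ≤ θ₁`,   `hliplb : α4 k * exp a * θ₁ ≤ lip k`   (E2 ∕ E5),
whereas repair item NE9-F8 part 2 stage B-i (`NE9LinSizePinned`, E2′ ∕ E5″, another seat) discharges them in the LINEAR SIZE: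
* `ha     : 2 ^ ν * log 2 + log (8 * ν) ≤ a`,          `hliplb : α4 k * 2 ^ (ν + 1 + 2 ^ ν) ≤ lip k`   (E2′ ∕ E5″).
From these SHAPES alone (hypotheses copied token for token):
§1 (cube currency)  `hθ₁` is satisfiable ONLY IF `a ≥ 2^ν·(1 + log D)` (`threshold_of_pinScalar`; sharp: `pinScalar_at_threshold`),
   and then `lipbar ≥ α4·e^{(2^ν − 1)(1 + log D)}` (`lipbar_lb_cube`, via N2-bis `lipbar_lb`);
§2 (T⁴, ν = 4, D = 8)  cube: `a > 49.27`, `lipbar ≥ α4·e^{46.19}`;  linear size: threshold `16·log 2 + log 32 = 21·log 2 < 14.557`,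
   constant `2^21 = 2097152 = e^{21·log 2}` a-FREE — lower threshold AND smaller constant (`lin_threshold_lt_cube_threshold_T4`,
   `lin_const_lt_cube_const_T4`), and no growth in `a`;
§3 in print's letters under the lineages' LOCATED dictionary `a ↔ δκ`, `δ = (1 − 2/L)/10` ([II] (2.18)×(1.36) = (2.20) p. 16, p. 21;
   a READING, not a printed statement), at print's smallest `L = 13` (`δ = 11/130`): cube currency NEEDS `κ > 582`, the linear
   size is served by every `κ ≥ 172.1` (print: «for κ sufficiently large», (1.26) p. 8);
§4 the fading product of E5″ (KP side still cube-count): `16(D+1)·2^(ν+1+2^ν)·α4·ε′·τ̄·e^{a′(1−2^{−ν}) + κ} ≤ 4·lipbar·a₁·τ̄`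
   (`fadingProduct_lb_pinnedLin`) — the factor `e^{a(1−2^{−ν})}` of N2-bis (P) is GONE, `e^{a′(1−2^{−ν})+κ}` REMAINS (stage B-ii);
   in print's letters the exponent drops from `X(L)·κ` to `X″(L)·κ`, `X″(L) = (3L + 56)/32` (`X2_closed_form`), and the break-even
   against print's `e^{−5κ}` (p. 18, p. 21) is UNCHANGED: `X″(33) < 5 < X″(35)` (`breakEven2`).
§B (on E5′ = stage B-ii `NE9LinSizeEnd`, KP side in the linear size) is appended when that face lands.

References (TYPE locators only; nothing printed is a hypothesis): T. Bałaban, CMP **116** (1988) 1–22 [Balaban1988RG2Cluster],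
(1.26) p. 8, (1.36) p. 9, (2.18)–(2.20) p. 16, p. 18 «exp 5κ», (2.30) p. 18, Lemma 3 (2.38) p. 20, p. 21; CMP **109** (1987)
[Balaban1987RG1] p. 251 («L … > 11»), p. 257.
-/

noncomputable section

namespace Summit.QuantumFields.BalabanUV.T4Continuum.NE9LinSizeCurrencyBudget

open Real
open Summit.QuantumFields.BalabanUV.T4Continuum.NE9CubeCurrencyBudget (log_sub_mul_le lipbar_lb budget_lb)

/-! ## §1 Cube currency: the threshold hidden in the pin scalar `hθ₁`, and the Lipschitz scale it forces -/

/-- **THRESHOLD OF THE CUBE-CURRENCY PIN SCALAR (kernel, necessary).**  E2∕E5's binder `hθ₁ : e^{−a/2^ν}·e^{Dθ₁} ≤ θ₁` with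
`1 ≤ D` forces `2^ν·(1 + log D) ≤ a` (take logarithms and use `log θ − Dθ ≤ −1 − log D`). [folklore] -/
theorem threshold_of_pinScalar {ν D : ℕ} {a θ₁ : ℝ} (hD : 1 ≤ D)
    (hθ₁ : Real.exp (-(a / 2 ^ ν)) * Real.exp (D * θ₁) ≤ θ₁) :
    (2:ℝ) ^ ν * (1 + Real.log D) ≤ a := by
  have hDpos : (0:ℝ) < D := by exact_mod_cast hD
  have hlhs : 0 < Real.exp (-(a / 2 ^ ν)) * Real.exp (D * θ₁) := by positivity
  have hθ₁pos : 0 < θ₁ := hlhs.trans_le hθ₁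
  have hlog := Real.log_le_log hlhs hθ₁
  rw [Real.log_mul (Real.exp_pos _).ne' (Real.exp_pos _).ne', Real.log_exp, Real.log_exp] at hlog
  have hmax := log_sub_mul_le hθ₁pos hDpos
  have h1 : 1 + Real.log D ≤ a / 2 ^ ν := by linarith
  have h2ν : (0:ℝ) < 2 ^ ν := by positivity
  calc (2:ℝ) ^ ν * (1 + Real.log D) ≤ 2 ^ ν * (a / 2 ^ ν) := mul_le_mul_of_nonneg_left h1 h2ν.le
    _ = a := by field_simp

/-- **SHARPNESS.**  At `a = 2^ν·(1 + log D)` the choice `θ₁ = 1/D` meets the pin scalar with EQUALITY: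
`e^{−(1 + log D)}·e^{D·D⁻¹} = D⁻¹`. [folklore] -/
theorem pinScalar_at_threshold {ν D : ℕ} (hD : 1 ≤ D) :
    Real.exp (-((2:ℝ) ^ ν * (1 + Real.log D) / 2 ^ ν)) * Real.exp ((D:ℝ) * (D:ℝ)⁻¹) = (D:ℝ)⁻¹ := by
  have hDpos : (0:ℝ) < D := by exact_mod_cast hD
  have hD0 : (D:ℝ) ≠ 0 := hDpos.ne'
  have h2ν : (2:ℝ) ^ ν ≠ 0 := by positivity
  rw [← Real.exp_add]
  have e : -((2:ℝ) ^ ν * (1 + Real.log D) / 2 ^ ν) + (D:ℝ) * (D:ℝ)⁻¹ = -Real.log D := by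
    field_simp
    ring
  rw [e, Real.exp_neg, Real.exp_log hDpos]

/-- **THE LIPSCHITZ SCALE FORCED IN CUBE CURRENCY.**  `hθ₁`, `hliplb : α4·e^{a}·θ₁ ≤ lip ≤ lipbar` give
`lipbar ≥ α4·e^{a(1 − 2^{−ν})}` (N2-bis `lipbar_lb`) and, with §1's threshold, `lipbar ≥ α4·e^{(2^ν − 1)(1 + log D)}` — a floor
independent of `a`, and growth `e^{a(1−2^{−ν})}` above it. [folklore] -/
theorem lipbar_lb_cube {ν D : ℕ} {a α4 θ₁ lip lipbar : ℝ} (hD : 1 ≤ D) (hα4 : 0 ≤ α4)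
    (hθ₁ : Real.exp (-(a / 2 ^ ν)) * Real.exp (D * θ₁) ≤ θ₁) (hliplb : α4 * Real.exp a * θ₁ ≤ lip)
    (hlipb : lip ≤ lipbar) : α4 * Real.exp ((2 ^ ν - 1) * (1 + Real.log D)) ≤ lipbar := by
  have h1 := lipbar_lb hα4 hθ₁ hliplb hlipb
  have h2 := threshold_of_pinScalar hD hθ₁
  have h2ν : (0:ℝ) < 2 ^ ν := by positivity
  have hfrac : 0 ≤ 1 - 1 / (2:ℝ) ^ ν := by
    have h1le : (1:ℝ) ≤ 2 ^ ν := one_le_pow₀ (by norm_num)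
    have : 1 / (2:ℝ) ^ ν ≤ 1 := by rw [div_le_one h2ν]; exact h1le
    linarith
  have h3 : ((2:ℝ) ^ ν - 1) * (1 + Real.log D) ≤ a * (1 - 1 / 2 ^ ν) := by
    have e : ((2:ℝ) ^ ν - 1) * (1 + Real.log D) = 2 ^ ν * (1 + Real.log D) * (1 - 1 / 2 ^ ν) := by
      field_simp
    rw [e]
    exact mul_le_mul_of_nonneg_right h2 hfrac
  calc α4 * Real.exp ((2 ^ ν - 1) * (1 + Real.log D))
      ≤ α4 * Real.exp (a * (1 - 1 / 2 ^ ν)) := mul_le_mul_of_nonneg_left (Real.exp_le_exp.2 h3) hα4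
    _ ≤ lipbar := h1

/-! ## §2 The two currencies on T⁴ (`ν = 4`, wall-adjacency degree `D = 8`) -/

/-- `log 8 = 3·log 2`. [folklore] -/
theorem log_eight : Real.log ((8:ℕ):ℝ) = 3 * Real.log 2 := by
  rw [show ((8:ℕ):ℝ) = 2 ^ 3 by norm_num, Real.log_pow]; norm_num

/-- `log 32 = 5·log 2` (the `log(8ν)` of the d-currency threshold at `ν = 4`). [folklore] -/
theorem log_thirtytwo : Real.log (8 * ((4:ℕ):ℝ)) = 5 * Real.log 2 := by
  rw [show (8 * ((4:ℕ):ℝ)) = 2 ^ 5 by norm_num, Real.log_pow]; norm_num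

/-- **CUBE CURRENCY ON T⁴: `a > 49.27` is NECESSARY** (`2^4·(1 + log 8) = 16 + 48·log 2 > 49.27`). [folklore] -/
theorem cube_threshold_T4 : (49.27 : ℝ) < (2:ℝ) ^ (4:ℕ) * (1 + Real.log ((8:ℕ):ℝ)) := by
  have h2 := Real.log_two_gt_d9
  rw [log_eight]
  have e : (2:ℝ) ^ (4:ℕ) = 16 := by norm_num
  rw [e]
  linarith

/-- **CUBE CURRENCY ON T⁴: the forced scale carries `e^{15(1 + log 8)} > e^{46.19}`.** [folklore] -/
theorem cube_lipExponent_T4 : (46.19 : ℝ) < ((2:ℝ) ^ (4:ℕ) - 1) * (1 + Real.log ((8:ℕ):ℝ)) := by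
  have h2 := Real.log_two_gt_d9
  rw [log_eight]
  have e : (2:ℝ) ^ (4:ℕ) = 16 := by norm_num
  rw [e]
  linarith

/-- the cube-currency scale floor on T⁴ as an inequality on `lipbar` (§1 + §2). [folklore] -/
theorem lipbar_lb_cube_T4 {a α4 θ₁ lip lipbar : ℝ} (hα4 : 0 ≤ α4)
    (hθ₁ : Real.exp (-(a / 2 ^ (4:ℕ))) * Real.exp (((8:ℕ):ℝ) * θ₁) ≤ θ₁) (hliplb : α4 * Real.exp a * θ₁ ≤ lip)
    (hlipb : lip ≤ lipbar) : α4 * Real.exp 46.19 ≤ lipbar := by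
  have h := lipbar_lb_cube (ν := 4) (D := 8) (by norm_num) hα4 hθ₁ hliplb hlipb
  exact le_trans (mul_le_mul_of_nonneg_left (Real.exp_le_exp.2 cube_lipExponent_T4.le) hα4) h

/-- **LINEAR SIZE ON T⁴: the threshold is `21·log 2`** (`16·log 2 + log 32`). [folklore] -/
theorem lin_threshold_T4 : (2:ℝ) ^ (4:ℕ) * Real.log 2 + Real.log (8 * ((4:ℕ):ℝ)) = 21 * Real.log 2 := by
  rw [log_thirtytwo]
  have e : (2:ℝ) ^ (4:ℕ) = 16 := by norm_num
  rw [e]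
  ring

/-- `14.556 < 21·log 2 < 14.557`. [folklore] -/
theorem lin_threshold_T4_bounds :
    (14.556 : ℝ) < (2:ℝ) ^ (4:ℕ) * Real.log 2 + Real.log (8 * ((4:ℕ):ℝ)) ∧
      (2:ℝ) ^ (4:ℕ) * Real.log 2 + Real.log (8 * ((4:ℕ):ℝ)) < 14.557 := by
  rw [lin_threshold_T4]
  have h1 := Real.log_two_gt_d9
  have h2 := Real.log_two_lt_d9
  constructor <;> linarith

/-- **LINEAR SIZE ON T⁴: the constant is `2^21 = 2097152`, a-free.** [folklore] -/
theorem lin_const_T4 : (2:ℝ) ^ (4 + 1 + 2 ^ 4) = 2097152 := by norm_num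

/-- On T⁴ the d-currency constant is EXACTLY `e^{threshold}`: `2^(4+1+2^4) = e^{21·log 2}` (since `8ν = 2^{ν+1}` at `ν = 4`).
[folklore] -/
theorem lin_const_eq_exp_threshold_T4 : (2:ℝ) ^ (4 + 1 + 2 ^ 4) = Real.exp (21 * Real.log 2) := by
  have h : Real.exp (21 * Real.log 2) = (2:ℝ) ^ (21:ℕ) := by
    rw [← Real.rpow_natCast, Real.rpow_def_of_pos (by norm_num : (0:ℝ) < 2)]
    congr 1; push_cast; ring
  rw [h]; norm_num

/-- **COMPARISON ON T⁴ (thresholds): the d-currency threshold is below the cube-currency one** (`21·log 2 < 16 + 48·log 2`).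
[folklore] -/
theorem lin_threshold_lt_cube_threshold_T4 :
    (2:ℝ) ^ (4:ℕ) * Real.log 2 + Real.log (8 * ((4:ℕ):ℝ)) < (2:ℝ) ^ (4:ℕ) * (1 + Real.log ((8:ℕ):ℝ)) := by
  calc (2:ℝ) ^ (4:ℕ) * Real.log 2 + Real.log (8 * ((4:ℕ):ℝ)) < 14.557 := lin_threshold_T4_bounds.2
    _ < 49.27 := by norm_num
    _ < (2:ℝ) ^ (4:ℕ) * (1 + Real.log ((8:ℕ):ℝ)) := cube_threshold_T4

/-- **COMPARISON ON T⁴ (constants): wherever the cube-currency pin scalar is satisfiable at all, its forced scale factor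
exceeds the a-free d-currency constant**: `2^21 < e^{15(1 + log 8)}` (indeed `e^{15(1+log 8)} = e^{15}·2^{45}`). [folklore] -/
theorem lin_const_lt_cube_const_T4 :
    (2:ℝ) ^ (4 + 1 + 2 ^ 4) < Real.exp (((2:ℝ) ^ (4:ℕ) - 1) * (1 + Real.log ((8:ℕ):ℝ))) := by
  have h45 : Real.exp (45 * Real.log 2) = (2:ℝ) ^ (45:ℕ) := by
    rw [← Real.rpow_natCast, Real.rpow_def_of_pos (by norm_num : (0:ℝ) < 2)]
    congr 1; push_cast; ring
  have e : ((2:ℝ) ^ (4:ℕ) - 1) * (1 + Real.log ((8:ℕ):ℝ)) = 15 + 45 * Real.log 2 := by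
    rw [log_eight]; norm_num; ring
  rw [e]
  calc (2:ℝ) ^ (4 + 1 + 2 ^ 4) < (2:ℝ) ^ (45:ℕ) := by norm_num
    _ = Real.exp (45 * Real.log 2) := h45.symm
    _ ≤ Real.exp (15 + 45 * Real.log 2) := Real.exp_le_exp.2 (by norm_num)

/-! ## §3 In print's letters: `a ↔ δκ`, `δ = (1 − 2/L)/10`, print's smallest `L = 13` (the lineages' LOCATED dictionary) -/

/-- `δ(13) = 11/130`. [folklore] -/
theorem delta_thirteen : (1 - 2 / (13:ℝ)) / 10 = 11 / 130 := by norm_num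

/-- **CUBE CURRENCY AT `L = 13`: `κ > 582` is NECESSARY** for E2∕E5's pin scalar (`a = δκ = 11κ/130 ≥ 16(1 + log 8) > 49.27`).
[folklore] -/
theorem cube_kappa_threshold_L13 {κ θ₁ : ℝ}
    (hθ₁ : Real.exp (-(11 / 130 * κ / 2 ^ (4:ℕ))) * Real.exp (((8:ℕ):ℝ) * θ₁) ≤ θ₁) : 582 < κ := by
  have h := threshold_of_pinScalar (ν := 4) (D := 8) (by norm_num) hθ₁
  have h2 := cube_threshold_T4
  linarith

/-- **LINEAR SIZE AT `L = 13`: every `κ ≥ 172.1` SERVES** E2′∕E5″'s threshold (`11κ/130 ≥ 14.5623 > 21·log 2`). [folklore] -/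
theorem lin_kappa_threshold_L13 {κ : ℝ} (hκ : 172.1 ≤ κ) :
    (2:ℝ) ^ (4:ℕ) * Real.log 2 + Real.log (8 * ((4:ℕ):ℝ)) ≤ 11 / 130 * κ := by
  have h := lin_threshold_T4_bounds.2
  linarith

/-! ## §4 The fading product of E5″: lip side repaired, KP side still cube-count -/

/-- **(P″) THE FADING PRODUCT THROUGH E5″.**  Under E5″'s binder shapes (`hliplb : α4·2^(ν+1+2^ν) ≤ lip ≤ lipbar` on the lip
side; `hθ`, `hεθ`, `hκd` unchanged on the KP side, so N2-bis `budget_lb` applies):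
`16(D+1)·2^(ν+1+2^ν)·α4·ε′·τ̄·exp(a′(1−2^{−ν}) + κ) ≤ 4·lipbar·a₁·τ̄` — compare N2-bis `fadingProduct_lb`: the factor
`e^{a(1−2^{−ν})}` is replaced by the a-FREE `2^(ν+1+2^ν)`; `e^{a′(1−2^{−ν})+κ}` remains. [folklore] -/
theorem fadingProduct_lb_pinnedLin {ν D : ℕ} {a' α4 ε' θ a₁ d₁ κ lip lipbar τbar : ℝ} (hα4 : 0 ≤ α4) (hε' : 0 ≤ ε')
    (hτbar : 0 ≤ τbar) (ha₁ : 0 ≤ a₁) (hκd : κ ≤ d₁)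
    (hliplb : α4 * 2 ^ (ν + 1 + 2 ^ ν) ≤ lip) (hlipb : lip ≤ lipbar)
    (hθ : 2 * Real.exp (-(a' / 2 ^ ν)) * Real.exp (a₁ + d₁) * Real.exp (D * θ) ≤ θ)
    (hεθ : 2 * (ε' * Real.exp a') * θ * ((D : ℝ) + 1) ≤ a₁) :
    16 * ((D : ℝ) + 1) * 2 ^ (ν + 1 + 2 ^ ν) * α4 * ε' * τbar * Real.exp (a' * (1 - 1 / 2 ^ ν) + κ) ≤
      4 * lipbar * a₁ * τbar := by
  have h1 : α4 * 2 ^ (ν + 1 + 2 ^ ν) ≤ lipbar := hliplb.trans hlipb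
  have h2 := budget_lb hε' ha₁ hκd hθ hεθ
  have hx : 0 ≤ α4 * 2 ^ (ν + 1 + 2 ^ ν) := by positivity
  have hy : 0 ≤ 4 * ((D : ℝ) + 1) * ε' * Real.exp (a' * (1 - 1 / 2 ^ ν) + κ) := by positivity
  have h12 : α4 * 2 ^ (ν + 1 + 2 ^ ν) * (4 * ((D : ℝ) + 1) * ε' * Real.exp (a' * (1 - 1 / 2 ^ ν) + κ)) ≤
      lipbar * a₁ := mul_le_mul h1 h2 hy (hx.trans h1)
  calc 16 * ((D : ℝ) + 1) * 2 ^ (ν + 1 + 2 ^ ν) * α4 * ε' * τbar * Real.exp (a' * (1 - 1 / 2 ^ ν) + κ)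
      = 4 * (α4 * 2 ^ (ν + 1 + 2 ^ ν) *
          (4 * ((D : ℝ) + 1) * ε' * Real.exp (a' * (1 - 1 / 2 ^ ν) + κ))) * τbar := by ring
    _ ≤ 4 * (lipbar * a₁) * τbar :=
        mul_le_mul_of_nonneg_right (mul_le_mul_of_nonneg_left h12 (by norm_num)) hτbar
    _ = 4 * lipbar * a₁ * τbar := by ring

/-- (P″) as a NECESSARY CONDITION for fading through E5″. [folklore] -/
theorem fade_necessary_pinnedLin {ν D : ℕ} {a' α4 ε' θ a₁ d₁ κ lip lipbar τbar ω : ℝ} (hα4 : 0 ≤ α4)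
    (hε' : 0 ≤ ε') (hτbar : 0 ≤ τbar) (ha₁ : 0 ≤ a₁) (hκd : κ ≤ d₁)
    (hliplb : α4 * 2 ^ (ν + 1 + 2 ^ ν) ≤ lip) (hlipb : lip ≤ lipbar)
    (hθ : 2 * Real.exp (-(a' / 2 ^ ν)) * Real.exp (a₁ + d₁) * Real.exp (D * θ) ≤ θ)
    (hεθ : 2 * (ε' * Real.exp a') * θ * ((D : ℝ) + 1) ≤ a₁) (hfade : ω + 4 * lipbar * a₁ * τbar < 1) :
    16 * ((D : ℝ) + 1) * 2 ^ (ν + 1 + 2 ^ ν) * α4 * ε' * τbar * Real.exp (a' * (1 - 1 / 2 ^ ν) + κ) < 1 - ω := by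
  have h := fadingProduct_lb_pinnedLin hα4 hε' hτbar ha₁ hκd hliplb hlipb hθ hεθ
  linarith

/-- **(P″) in print's letters: the exponent `X″(L)`.**  With `a′ = (1−8δ)(L/2)κ` ((2.38) after the (2.36) rescaling) and
`ν = 4`: `a′(1 − 1/16) + κ = X″·κ`, `X″ = 15(1−8δ)L/32 + 1` — N2-bis' `X(L)` minus the removed share `15δ/16`. [folklore] -/
theorem exponent2_eq (δ L κ : ℝ) :
    (1 - 8 * δ) * (L / 2) * κ * (1 - 1 / 2 ^ (4 : ℕ)) + κ = (15 * (1 - 8 * δ) * L / 32 + 1) * κ := by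
  norm_num; ring

/-- the removed share: `X(L) − X″(L) = 15δ/16`. [folklore] -/
theorem X_sub_X2 (δ L : ℝ) :
    (15 * δ / 16 + 15 * (1 - 8 * δ) * L / 32 + 1) - (15 * (1 - 8 * δ) * L / 32 + 1) = 15 * δ / 16 := by ring

/-- `X″(L)` at print's `δ = (1 − 2/L)/10`: `X″(L) = (3L + 56)/32`. [folklore] -/
theorem X2_closed_form {L : ℝ} (hL : L ≠ 0) :
    15 * (1 - 8 * ((1 - 2 / L) / 10)) * L / 32 + 1 = (3 * L + 56) / 32 := by
  field_simp
  ring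

/-- **BREAK-EVEN UNCHANGED BY STAGE B-i.**  Against print's `e^{−5κ}` (p. 18 «…exp 5κ ≤ 1», p. 21): `X″(33) = 155/32 < 5 <
161/32 = X″(35)` — exactly N2-bis' break-even (`breakEven`: `X(33) < 5 < X(35)`); the `e^{a′(1−2^{−ν})}` of the cube-count KP
side dominates, its removal is stage B-ii. [folklore] -/
theorem breakEven2 : (3 * (33 : ℝ) + 56) / 32 < 5 ∧ (5 : ℝ) < (3 * 35 + 56) / 32 := by
  constructor <;> norm_num

/-- At print's smallest `L = 13`: `X″(13) = 95/32 < 2.97` (N2-bis: `X(13) < 3.05`). [folklore] -/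
theorem X2_thirteen : (3 * (13 : ℝ) + 56) / 32 < 2.97 := by norm_num

end Summit.QuantumFields.BalabanUV.T4Continuum.NE9LinSizeCurrencyBudget

end
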